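import Summits.AtomisticToContinuum.Crystallization.Theorems.FrustratedLawDichotomyRootedMark

/-!
# FrustratedLawDichotomy · crux `AperiodicFrustratedLawGap` (stmt-AtomisticToContinuum-27623) — «CoordPull»: THE COORDINATION MARK AND THE
# COORDINATION PULL (decomp-a2c, (404′) transported line, hand-1 g58, part B of two; the «over-coordination-charging income kernel» the K2 price
# sheet of record leaves open — critic r1926 / r1930 — typed as INFRASTRUCTURE ONLY: no cap `D_T`, no reach figure, nothing on A(η))

Part A `…RootedMark` makes every Giry-measurable target `C ⊆ Measure E3` an admissible covariant, jointly measurable mark `RootedMark δ C` for the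
cell-free pull kernel (329).  This file instantiates it at the simplest statistic no TEMPLATE atlas ((334′) `HostLikeAt`, (404′) `Uncompressed`)
expresses — the COORDINATION NUMBER — and plugs the resulting kernel into the (404′) reach bookkeeping:

* §1 ★ THE COORDINATION MARK `OverCoord δ k ρ := RootedMark δ {ν | k ≤ ν (coordShell ρ)}`, `coordShell ρ = closedBall 0 ρ ∖ {0}`: «at least `k`
  OTHER atoms within `ρ` of `y`» (`overCoord_iff_of_atom`; finset forms `overCoord_of_finset` / `not_overCoord_of_subset_finset` for certificate
  files); jointly measurable for `δ > 0` (`Measure.measurable_coe` + part A), exactly covariant (`overCoord_hshift`).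
* §2 ★ THE COORDINATION PULL `coordPull δ k ρ R a := pullKernel (OverCoord δ k ρ) R (fun _ ↦ a)`: an over-coordinated root pulls the constant
  `a` from every under-coordinated atom within `R`.  Door clauses of (325) by name (`measurable_coordPull`, `exists_outflow_bound_coordPull`,
  `exists_inflow_bound_coordPull`); the payer mechanism both ways (`card_mul_le_net_coordPull` / `transportedDeficit_le_of_undercoordinated`:
  an over-coordinated root's transported deficit DROPS by `a` per under-coordinated atom within `R`; `neg_card_mul_le_net_coordPull`: an
  under-coordinated root PAYS at most `a` per over-coordinated atom within `R`); verbatim floors at over-coordinated roots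
  (`floorT_of_floor_overCoord`) and at under-coordinated roots whose `R`-window holds no over-coordinated atom (`floorT_of_floor_coordClear`,
  the reading of a template cell whose pull window is template-like); FENCE `exists_capT_coordPull`: the transported cap slot of (404′) is
  INHABITED for this kernel (some finite `D ≥ 0`, (421) §5 pattern — no value claimed).
* §3 the (404′) lines with the kernel plugged in and the door clauses discharged: `coherentMassExclusion_coordPull` (F(η) ⟸ transported floors
  ∧ a coordination-pull cap `D` ∧ `η ≤ reach m D`) and ★★ `aperiodicFrustratedLawGap_of_offAtlasMassGap_coordPull` (crux BY NAME ⟸ the same ∧ A(η)).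
HONEST LABELS.  The over-bound roots that floor the dials of record — (410): 24 compressed first-shell atoms; (434): 20 contact-free first-shell
atoms — are OVER-COORDINATED, hence EARNERS under this kernel; whether their income books the `0.24888` floor away (as (421) booked (410)'s `0.613`
away for `compPull`), and what an icosahedral-centre root with a dense SECOND shell (coordination 12: under-coordinated at `k = 13`, hence a PAYER)
does to the cap, is Negative-lane business and NOT decided here; no `D_T` is certified (K2), A(η) is untouched.  [folklore: bookkeeping]
throughout; the mark and the kernel are [new: dial], the payer lemmas [new: mechanism], §3 [new: junction].  Imports: part A only (hence (334′),
(329), (404′), (404)).  3 plain `def`s (`coordShell`, `OverCoord`, `coordPull`); no instance / notation / option; no `decide`; 0 sorry.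
-/

noncomputable section

namespace Summit.AtomisticToContinuum.Crystallization.Theorems.FrustratedLawDichotomyCoordPull

open MeasureTheory Metric Set Filter
open scoped ENNReal BigOperators
open Literature.MathematicalPhysics.StatisticalMechanics (rootEnergy lennardJones)
open Literature.Probability.Process (IsRootedHardCore count_restrict_singleton_ne_zero_iff)
open Literature.Probability.Process.LocalConfig (isClosed_of_separated)
open Summit.AtomisticToContinuum.Crystallization.Theorems.ChargedEnergyGapNegative (E3 eStar)
open Summit.AtomisticToContinuum.Crystallization.Theorems.FrustratedLawDichotomySignedLedger (net)
open Summit.AtomisticToContinuum.Crystallization.Theorems.FrustratedLawDichotomyPullKernel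
open Summit.AtomisticToContinuum.Crystallization.Theorems.FrustratedLawDichotomyAtlasReach (reach Duniv Duniv_nonneg deficit_le_Duniv OffAtlasMassGap
  CoherentMassExclusion)
open Summit.AtomisticToContinuum.Crystallization.Theorems.FrustratedLawDichotomyTransportPriceLocal (exists_outflow_bound_of_finiteRange)
open Summit.AtomisticToContinuum.Crystallization.Theorems.FrustratedLawDichotomyAtlasReachTransport (coherentMassExclusion_of_floorsT
  aperiodicFrustratedLawGap_of_offAtlasMassGapT)
open Summit.AtomisticToContinuum.Crystallization.Theorems.FrustratedLawDichotomyRootedMark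

variable {δ : ℝ} {μ : Measure E3} {y : E3}

/-! ## §1. The coordination mark -/

/-- The COORDINATION SHELL of radius `ρ` about the root: the closed `ρ`-ball with the root removed. [new: dial] -/
def coordShell (ρ : ℝ) : Set E3 := closedBall 0 ρ \ {0}

/-- The coordination shell is measurable. [folklore] -/
theorem measurableSet_coordShell (ρ : ℝ) : MeasurableSet (coordShell ρ) := measurableSet_closedBall.diff (measurableSet_singleton 0)

/-- The target «at least `k` atoms in the coordination shell» is a Giry-measurable set of measures. [folklore] -/
theorem measurableSet_coordTarget (k : ℕ) (ρ : ℝ) : MeasurableSet {ν : Measure E3 | (k : ℝ≥0∞) ≤ ν (coordShell ρ)} :=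
  measurableSet_le measurable_const (Measure.measurable_coe (measurableSet_coordShell ρ))

/-- ★ **THE COORDINATION MARK** `OverCoord δ k ρ μ y`: re-rooted at `y`, `μ` is rooted `δ`-hard-core and carries AT LEAST `k` atoms in the
coordination shell — `y` has at least `k` OTHER atoms within distance `ρ`.  A rooted mark. [new: dial] -/
def OverCoord (δ : ℝ) (k : ℕ) (ρ : ℝ) : Measure E3 → E3 → Prop := RootedMark δ {ν : Measure E3 | (k : ℝ≥0∞) ≤ ν (coordShell ρ)}

variable {k : ℕ} {ρ : ℝ}

/-- Exact covariance of the coordination mark (the `hshift` of (329)). [folklore] -/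
theorem overCoord_hshift (δ : ℝ) (k : ℕ) (ρ : ℝ) :
    ∀ (μ : Measure E3) (y z : E3), OverCoord δ k ρ (μ.map fun x => x - y) z ↔ OverCoord δ k ρ μ (z + y) :=
  rootedMark_hshift δ _

/-- ★ Joint measurability of the coordination mark (the `hmeas` of (329)/(334)), for `δ > 0`. [folklore] -/
theorem measurableSet_overCoord (hδ : 0 < δ) (k : ℕ) (ρ : ℝ) : MeasurableSet {p : Measure E3 × E3 | OverCoord δ k ρ p.1 p.2} :=
  measurableSet_rootedMark hδ (measurableSet_coordTarget k ρ)

/-- The re-rooted mass of the coordination shell is the mass of the punctured ball about `y`. [folklore] -/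
theorem map_sub_apply_coordShell (μ : Measure E3) (y : E3) (ρ : ℝ) : (μ.map fun x => x - y) (coordShell ρ) = μ (closedBall y ρ \ {y}) := by
  rw [Measure.map_apply (measurable_sub_const y) (measurableSet_coordShell ρ)]
  congr 1
  ext x
  simp only [coordShell, mem_preimage, Set.mem_sdiff, mem_closedBall, mem_singleton_iff, sub_eq_zero, dist_eq_norm, sub_zero]

/-- ★ **READING AT AN ATOM**: at an atom `y` of a rooted hard-core configuration, `OverCoord δ k ρ μ y` iff the punctured closed `ρ`-ball about `y`
carries mass `≥ k` — at least `k` other atoms within `ρ`. [folklore] -/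
theorem overCoord_iff_of_atom (hμ : IsRootedHardCore δ μ) (hy : μ {y} ≠ 0) : OverCoord δ k ρ μ y ↔ (k : ℝ≥0∞) ≤ μ (closedBall y ρ \ {y}) := by
  unfold OverCoord
  rw [rootedMark_iff_of_atom hμ hy, mem_setOf_eq, map_sub_apply_coordShell]

/-- The coordination mark at the root. [folklore] -/
theorem overCoord_zero_iff (μ : Measure E3) : OverCoord δ k ρ μ 0 ↔ IsRootedHardCore δ μ ∧ (k : ℝ≥0∞) ≤ μ (coordShell ρ) :=
  rootedMark_zero_iff μ

/-- Over-coordinated points are atoms. -/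
theorem OverCoord.apply_singleton_ne_zero (h : OverCoord δ k ρ μ y) : μ {y} ≠ 0 := RootedMark.apply_singleton_ne_zero h

/-- ★ FINSET FORM (sufficient): `k` distinct atoms other than `y` within `ρ` of the atom `y` make `y` over-coordinated. [folklore] -/
theorem overCoord_of_finset (hμ : IsRootedHardCore δ μ) (hy : μ {y} ≠ 0) (T : Finset E3)
    (hT : ∀ z ∈ T, μ {z} ≠ 0 ∧ z ≠ y ∧ dist z y ≤ ρ) (hk : k ≤ T.card) : OverCoord δ k ρ μ y := by
  rw [overCoord_iff_of_atom hμ hy]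
  obtain ⟨S, -, -, rfl⟩ := hμ
  have hTS : (↑T : Set E3) ⊆ S := fun z hz => (count_restrict_singleton_ne_zero_iff S z).1 (hT z hz).1
  have hsub : (↑T : Set E3) ⊆ closedBall y ρ \ {y} := fun z hz =>
    ⟨mem_closedBall.2 (hT z hz).2.2, fun h => (hT z hz).2.1 (mem_singleton_iff.1 h)⟩
  calc (k : ℝ≥0∞) ≤ T.card := by exact_mod_cast hk
    _ = Measure.count (↑T : Set E3) := (Measure.count_apply_finset T).symm
    _ = Measure.count (↑T ∩ S) := by rw [inter_eq_left.2 hTS]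
    _ = (Measure.count : Measure E3).restrict S ↑T := (Measure.restrict_apply T.measurableSet).symm
    _ ≤ (Measure.count : Measure E3).restrict S (closedBall y ρ \ {y}) := measure_mono hsub

/-- ★ FINSET FORM (necessary): if every atom other than `y` within `ρ` of the atom `y` lies in a finset with fewer than `k` elements, `y` is NOT
over-coordinated. [folklore] -/
theorem not_overCoord_of_subset_finset (hμ : IsRootedHardCore δ μ) (hy : μ {y} ≠ 0) (T : Finset E3)
    (hT : ∀ z : E3, μ {z} ≠ 0 → z ≠ y → dist z y ≤ ρ → z ∈ T) (hk : T.card < k) : ¬ OverCoord δ k ρ μ y := by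
  rw [overCoord_iff_of_atom hμ hy, not_le]
  obtain ⟨S, -, -, rfl⟩ := hμ
  have hsub : (closedBall y ρ \ {y}) ∩ S ⊆ ↑T := fun z hz =>
    hT z ((count_restrict_singleton_ne_zero_iff S z).2 hz.2) (fun h => hz.1.2 (mem_singleton_iff.2 h)) (mem_closedBall.1 hz.1.1)
  calc (Measure.count : Measure E3).restrict S (closedBall y ρ \ {y})
        = Measure.count ((closedBall y ρ \ {y}) ∩ S) := Measure.restrict_apply (measurableSet_closedBall.diff (measurableSet_singleton y))
    _ ≤ Measure.count (↑T : Set E3) := measure_mono hsub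
    _ = T.card := Measure.count_apply_finset T
    _ < k := by exact_mod_cast hk

/-! ## §2. The coordination pull -/

/-- ★ **THE COORDINATION PULL** `coordPull δ k ρ R a`: an over-coordinated root (at least `k` other atoms within `ρ`) pulls the constant `a` from every
under-coordinated atom within `R` — the cell-free pull kernel of the coordination mark with constant weight. [new: dial] -/
def coordPull (δ : ℝ) (k : ℕ) (ρ R a : ℝ) : Measure E3 → E3 → ℝ≥0∞ := pullKernel (OverCoord δ k ρ) R fun _ => ENNReal.ofReal a

variable {a : ℝ}

/-- Door clause `hG` of (325): the coordination pull is jointly measurable (`δ > 0`). [folklore] -/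
theorem measurable_coordPull (hδ : 0 < δ) (k : ℕ) (ρ R a : ℝ) : Measurable (Function.uncurry (coordPull δ k ρ R a)) :=
  measurable_pullKernel (measurableSet_overCoord hδ k ρ) measurable_const

/-- Door clauses `hBG`, `hGb` of (325): uniformly bounded out-flow on rooted `δ`-hard-core configurations ((329) `exists_outflow_bound_pullKernel`). [folklore] -/
theorem exists_outflow_bound_coordPull (hδ : 0 < δ) (k : ℕ) (ρ R a : ℝ) :
    ∃ B : ℝ≥0∞, B ≠ ∞ ∧ ∀ μ : Measure E3, IsRootedHardCore δ μ → ∫⁻ y, coordPull δ k ρ R a μ y ∂μ ≤ B :=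
  exists_outflow_bound_pullKernel hδ _ R ENNReal.ofReal_ne_top fun _ => le_rfl

/-- What a root PAYS under the coordination pull is uniformly bounded on rooted `δ`-hard-core configurations ((421) §5 pattern, via the route-own
`…TransportPriceLocal.exists_outflow_bound_of_finiteRange`). [folklore] -/
theorem exists_inflow_bound_coordPull (hδ : 0 < δ) (k : ℕ) (ρ R a : ℝ) : ∃ B : ℝ≥0∞, B ≠ ∞ ∧ ∀ μ : Measure E3, IsRootedHardCore δ μ →
    ∫⁻ y, coordPull δ k ρ R a (μ.map fun x => x - y) (-y) ∂μ ≤ B := by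
  obtain ⟨B, hB, hBb⟩ := exists_outflow_bound_of_finiteRange hδ R (ENNReal.ofReal_ne_top (r := a))
  exact ⟨B, hB, fun μ hμ => hBb μ hμ _ (fun y => pullKernel_le _ _) fun y hy => pullKernel_eq_zero_of_lt_norm (by rwa [norm_neg])⟩

/-- Transported floors at OVER-COORDINATED roots come for free from sitewise floors ((329) `floor_add_net_of_floor`). [folklore] -/
theorem floorT_of_floor_overCoord {R : ℝ} (h0 : OverCoord δ k ρ μ 0) {c m : ℝ} (h : c + m ≤ rootEnergy lennardJones μ) :
    c + m ≤ rootEnergy lennardJones μ + net 0 (coordPull δ k ρ R a) μ :=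
  floor_add_net_of_floor (overCoord_hshift δ k ρ) h0 h

/-- ★ Transported floors at UNDER-COORDINATED roots whose `R`-window holds NO over-coordinated atom are the sitewise floors verbatim (part A
`floor_add_net_of_floor_clear`) — the reading of a template cell whose pull window is template-like. [folklore] -/
theorem floorT_of_floor_coordClear (hδ : 0 < δ) {R : ℝ} (hμ : IsRootedHardCore δ μ) (h0 : ¬ OverCoord δ k ρ μ 0)
    (hclear : ∀ z : E3, μ {z} ≠ 0 → ‖z‖ ≤ R → ¬ OverCoord δ k ρ μ z) {c m : ℝ} (h : c + m ≤ rootEnergy lennardJones μ) :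
    c + m ≤ rootEnergy lennardJones μ + net 0 (coordPull δ k ρ R a) μ :=
  floor_add_net_of_floor_clear hδ (overCoord_hshift δ k ρ) hμ h0 hclear h

/-- At an over-coordinated root the net flow of the coordination pull is its out-flow. [folklore] -/
theorem net_coordPull_of_root {R : ℝ} (h0 : OverCoord δ k ρ μ 0) :
    net 0 (coordPull δ k ρ R a) μ = (∫⁻ y, coordPull δ k ρ R a μ y ∂μ).toReal :=
  net_zero_pullKernel_of_mark (overCoord_hshift δ k ρ) h0

/-- ★ **UNDER-COORDINATED NEIGHBOURS PAY THE OVER-COORDINATED ROOT**: at a rooted `δ`-hard-core configuration (`δ > 0`) with over-coordinated root,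
every finite set `T` of under-coordinated atoms within `R` contributes `|T|·a` to the root's income. [new: mechanism] -/
theorem card_mul_le_net_coordPull (hδ : 0 < δ) {R : ℝ} (ha : 0 ≤ a) (hμ : IsRootedHardCore δ μ) (h0 : OverCoord δ k ρ μ 0) (T : Finset E3)
    (hT : ∀ y ∈ T, μ {y} ≠ 0 ∧ ‖y‖ ≤ R ∧ ¬ OverCoord δ k ρ μ y) : (T.card : ℝ) * a ≤ net 0 (coordPull δ k ρ R a) μ := by
  obtain ⟨B, hB, hBb⟩ := exists_outflow_bound_coordPull hδ k ρ R a
  exact card_mul_le_net_pullKernel (overCoord_hshift δ k ρ) hμ h0 ha (ne_top_of_le_ne_top hB (hBb μ hμ)) T hT fun _ _ => le_rfl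

/-- ★ **THE TRANSPORTED DEFICIT AT AN OVER-COORDINATED ROOT**: `c − rootEnergy μ − net ≤ c − rootEnergy μ − |T|·a` for every finite set `T` of
under-coordinated atoms within `R` — the income an over-bound root books under the coordination pull. [new: mechanism] -/
theorem transportedDeficit_le_of_undercoordinated (hδ : 0 < δ) {R : ℝ} (ha : 0 ≤ a) (hμ : IsRootedHardCore δ μ) (h0 : OverCoord δ k ρ μ 0)
    (T : Finset E3) (hT : ∀ y ∈ T, μ {y} ≠ 0 ∧ ‖y‖ ≤ R ∧ ¬ OverCoord δ k ρ μ y) (c : ℝ) :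
    c - rootEnergy lennardJones μ - net 0 (coordPull δ k ρ R a) μ ≤ c - rootEnergy lennardJones μ - T.card * a := by
  linarith [card_mul_le_net_coordPull hδ ha hμ h0 T hT]

/-- What an UNDER-COORDINATED root pays: at most `a` per over-coordinated atom within `R` (part A `neg_le_net_pullKernel_of_not_mark` with the
finset count): if the over-coordinated atoms within `R` all lie in a finset `T`, the net flow is `≥ −|T|·a`. [new: mechanism] -/
theorem neg_card_mul_le_net_coordPull (hδ : 0 < δ) {R : ℝ} (ha : 0 ≤ a) (hμ : IsRootedHardCore δ μ) (h0 : ¬ OverCoord δ k ρ μ 0) (T : Finset E3)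
    (hT : ∀ z : E3, μ {z} ≠ 0 → ‖z‖ ≤ R → OverCoord δ k ρ μ z → z ∈ T) : -((T.card : ℝ) * a) ≤ net 0 (coordPull δ k ρ R a) μ := by
  have hcount : μ {z : E3 | ‖z‖ ≤ R ∧ OverCoord δ k ρ μ z} ≤ T.card := by
    obtain ⟨S, -, hsep, rfl⟩ := hμ
    have hsub : {z : E3 | ‖z‖ ≤ R ∧ OverCoord δ k ρ ((Measure.count : Measure E3).restrict S) z} ∩ S ⊆ ↑T := fun z hz =>
      hT z ((count_restrict_singleton_ne_zero_iff S z).2 hz.2) hz.1.1 hz.1.2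
    calc (Measure.count : Measure E3).restrict S {z : E3 | ‖z‖ ≤ R ∧ OverCoord δ k ρ ((Measure.count : Measure E3).restrict S) z}
          = Measure.count ({z : E3 | ‖z‖ ≤ R ∧ OverCoord δ k ρ ((Measure.count : Measure E3).restrict S) z} ∩ S) :=
            Measure.restrict_apply' (isClosed_of_separated hδ hsep).measurableSet
      _ ≤ Measure.count (↑T : Set E3) := measure_mono hsub
      _ = T.card := Measure.count_apply_finset T
  have hfin : ENNReal.ofReal a * μ {z : E3 | ‖z‖ ≤ R ∧ OverCoord δ k ρ μ z} ≠ ∞ :=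
    ENNReal.mul_ne_top ENNReal.ofReal_ne_top (ne_top_of_le_ne_top (ENNReal.natCast_ne_top T.card) hcount)
  have h := neg_le_net_pullKernel_of_not_mark (R := R) (w := fun _ => ENNReal.ofReal a) (overCoord_hshift δ k ρ) (fun _ => le_rfl) h0 hfin
  refine le_trans ?_ h
  rw [neg_le_neg_iff, ENNReal.toReal_mul, ENNReal.toReal_ofReal ha, mul_comm]
  exact mul_le_mul_of_nonneg_right (by
    have := ENNReal.toReal_mono (ENNReal.natCast_ne_top T.card) hcount
    rwa [ENNReal.toReal_natCast] at this) ha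

/-- ★ FENCE: the transported cap slot `hcapT` of (404′) is INHABITED for the coordination pull at hard core `7/10` — some finite `D ≥ 0` works
((404)'s `D_univ` plus the in-flow bound).  No numeric value is claimed (that is a K2 certificate). [new: bookkeeping] -/
theorem exists_capT_coordPull (k : ℕ) (ρ R a : ℝ) : ∃ D : ℝ, 0 ≤ D ∧ ∀ μ : Measure E3, IsRootedHardCore (7 / 10) μ →
    eStar - rootEnergy lennardJones μ - net 0 (coordPull (7 / 10) k ρ R a) μ ≤ D := by
  obtain ⟨B, hB, hBb⟩ := exists_inflow_bound_coordPull (by norm_num : (0 : ℝ) < 7 / 10) k ρ R a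
  refine ⟨Duniv + B.toReal, add_nonneg Duniv_nonneg ENNReal.toReal_nonneg, fun μ hμ => ?_⟩
  have hd := deficit_le_Duniv μ hμ
  have hB0 : 0 ≤ B.toReal := ENNReal.toReal_nonneg
  by_cases h0 : OverCoord (7 / 10) k ρ μ 0
  · have h1 : 0 ≤ net 0 (coordPull (7 / 10) k ρ R a) μ := net_zero_pullKernel_nonneg_of_mark (overCoord_hshift (7 / 10) k ρ) h0
    linarith
  · have h1 : net 0 (coordPull (7 / 10) k ρ R a) μ = -(∫⁻ y, coordPull (7 / 10) k ρ R a (μ.map fun x => x - y) (-y) ∂μ).toReal :=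
      net_zero_pullKernel_of_not_mark h0
    have h2 := ENNReal.toReal_mono hB (hBb μ hμ)
    linarith

/-! ## §3. The (404′) lines with the coordination pull plugged in -/

/-- ★ F(η) FROM TRANSPORTED FLOORS AND A TRANSPORTED CAP UNDER THE COORDINATION PULL ((404′) `coherentMassExclusion_of_floorsT` with `F = 0`,
`G = coordPull (7/10) k ρ R a`, door clauses discharged by §2): the reach dial reads a coordination-pull cap `D` exactly as it reads any other.
No `D` is supplied here. [new: junction] -/
theorem coherentMassExclusion_coordPull (k : ℕ) (ρ R a : ℝ) (n : ℕ) (K : ℕ → Set (MeasureTheory.Measure (EuclideanSpace ℝ (Fin 3))))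
    (hK : ∀ i, MeasurableSet (K i)) (mK : ℕ → ℝ)
    (hfloorT : ∀ i < n, ∀ μ : Measure E3, IsRootedHardCore (7 / 10) μ →
      (∀ p : E3, μ {p} ≠ 0 → ∀ y : E3, (∀ q : E3, μ {q} ≠ 0 → q ≠ p → y ≠ q) →
        ∑' q : {q : E3 // μ {q} ≠ 0 ∧ q ≠ p}, lennardJones (dist p (q : E3)) ≤ ∑' q : {q : E3 // μ {q} ≠ 0 ∧ q ≠ p}, lennardJones (dist y (q : E3))) →
      μ ∈ K i → eStar + mK i ≤ rootEnergy lennardJones μ + net 0 (coordPull (7 / 10) k ρ R a) μ)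
    {m D : ℝ} (hm0 : 0 < m) (hD : 0 ≤ D) (hm : ∀ i < n, m ≤ mK i)
    (hcapT : ∀ μ : Measure E3, IsRootedHardCore (7 / 10) μ → eStar - rootEnergy lennardJones μ - net 0 (coordPull (7 / 10) k ρ R a) μ ≤ D)
    {η : ℝ} (hη : η ≤ reach m D) : CoherentMassExclusion n K η := by
  obtain ⟨B, hB, hBb⟩ := exists_outflow_bound_coordPull (by norm_num : (0 : ℝ) < 7 / 10) k ρ R a
  exact coherentMassExclusion_of_floorsT n K hK mK 0 (coordPull (7 / 10) k ρ R a) measurable_zero_kernel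
    (measurable_coordPull (by norm_num) k ρ R a) ENNReal.zero_ne_top hB (fun μ _ => lintegral_outflow_zero_kernel_le μ 0) hBb hfloorT hm0 hD hm
    hcapT hη

/-- ★★ **THE CRUX BY NAME UNDER THE COORDINATION PULL** ((404′) `aperiodicFrustratedLawGap_of_offAtlasMassGapT`): transported row floors for
`coordPull (7/10) k ρ R a`, a transported cap `D` for it, and the residual A(η) = `OffAtlasMassGap n K η` at `η ≤ reach m D` prove
`AperiodicFrustratedLawGap`.  Remaining hypotheses, honestly: the floors (K-files, verbatim at over-coordinated roots and at clear windows by §2),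
the cap `D` (K2, uncertified), A(η) (the declared residual, untouched). [new: junction] -/
theorem aperiodicFrustratedLawGap_of_offAtlasMassGap_coordPull (k : ℕ) (ρ R a : ℝ) (n : ℕ)
    (K : ℕ → Set (MeasureTheory.Measure (EuclideanSpace ℝ (Fin 3)))) (hK : ∀ i, MeasurableSet (K i)) (mK : ℕ → ℝ)
    (hfloorT : ∀ i < n, ∀ μ : Measure E3, IsRootedHardCore (7 / 10) μ →
      (∀ p : E3, μ {p} ≠ 0 → ∀ y : E3, (∀ q : E3, μ {q} ≠ 0 → q ≠ p → y ≠ q) →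
        ∑' q : {q : E3 // μ {q} ≠ 0 ∧ q ≠ p}, lennardJones (dist p (q : E3)) ≤ ∑' q : {q : E3 // μ {q} ≠ 0 ∧ q ≠ p}, lennardJones (dist y (q : E3))) →
      μ ∈ K i → eStar + mK i ≤ rootEnergy lennardJones μ + net 0 (coordPull (7 / 10) k ρ R a) μ)
    {m D : ℝ} (hm0 : 0 < m) (hD : 0 ≤ D) (hm : ∀ i < n, m ≤ mK i)
    (hcapT : ∀ μ : Measure E3, IsRootedHardCore (7 / 10) μ → eStar - rootEnergy lennardJones μ - net 0 (coordPull (7 / 10) k ρ R a) μ ≤ D)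
    {η : ℝ} (hη : η ≤ reach m D) (hA : OffAtlasMassGap n K η) :
    Summit.AtomisticToContinuum.Crystallization.Theses.FrustratedLawDichotomy.AperiodicFrustratedLawGap := by
  obtain ⟨B, hB, hBb⟩ := exists_outflow_bound_coordPull (by norm_num : (0 : ℝ) < 7 / 10) k ρ R a
  exact aperiodicFrustratedLawGap_of_offAtlasMassGapT n K hK mK 0 (coordPull (7 / 10) k ρ R a) measurable_zero_kernel
    (measurable_coordPull (by norm_num) k ρ R a) ENNReal.zero_ne_top hB (fun μ _ => lintegral_outflow_zero_kernel_le μ 0) hBb hfloorT hm0 hD hm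
    hcapT hη hA

end Summit.AtomisticToContinuum.Crystallization.Theorems.FrustratedLawDichotomyCoordPull

end
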